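import Summits.AnomalousDissipation.AnomalousDissipation.Theses.TameRoughRigidity
import Summits.AnomalousDissipation.AnomalousDissipation.Theorems.TameToRough.Negative.Structure
import Summits.AnomalousDissipation.AnomalousDissipation.Theorems.TaylorCertificatesSteadyStatesLoudBoundedStubGpAdmissible
import Summits.AnomalousDissipation.AnomalousDissipation.Theorems.TameRoughRigidityTameToRoughEvenSymmetrise
import Summits.AnomalousDissipation.AnomalousDissipation.Theorems.TameRoughRigidityTameToRoughOddWeightedBudget
import Literature.Analysis.FluidPDE.CylindricalGenerator
import HarnessLib

/-!
# Conditional Onsager calibration — crux `TameRoughRigidity.TameToRough` (stmt-AnomalousDissipation-18401),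
# line `Sketch` (card `Cruxes/TameToRough/Ideas/cosigned-flux-witness.md`): SKELETON

R (#3 of route `route-AnomalousDissipation-TameRoughRigidity`): IF every tame class of probability measures on
`H = L²_σ(T³)` (integrable energy `≤ E`, mean enstrophy `≤ G₁`) carries a cylindrical forced-Euler defect gap for the
Galloway–Proctor force `f_GP`, THEN at every energy level `E` there are `G₁, c, δ₀ > 0` such that every admissible
near-statistics `μ` (probability, integrable energy `≤ E`, finite mean enstrophy `G ≥ G₁`, shell work `≥ 0`) with
defect constant `R ≤ δ₀` pays `c ≤ R √G`.

LINE (odd-weighted product witnesses). For a cylindrical test `Φ` (profile `φ`, fields `gᵢ`) and a bounded odd `C¹`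
weight `ψ` of the same coordinates, the PRODUCT test `v ↦ ψ(coords v)·Φ(v)` is cylindrical, with differential
`ψ(coords v) Φ'(v) + Φ(v) Ψ'(v)`, `Ψ'(v) := ∑ᵢ ∂ᵢψ(coords v) gᵢ`; the defect clause at this test and Minkowski give the
ODD-WEIGHTED BUDGET inequality (S1)
`|∫ (ψ·⟨F₀(v), Φ'(v)⟩ + Φ(v)·⟨F₀(v), Ψ'(v)⟩) dμ| ≤ R (‖∇Φ'‖_{L²(μ;L²)} + K ‖∇Ψ'‖_{L²(μ;L²)})`, `|φ| ≤ K`, `|ψ| ≤ 1`.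
By time-reversal symmetrisation (S0, pattern: the landed `stub_desaturation`) it suffices to calibrate EVEN measures
(`T_*μ = μ`, `T v = −v`), on which every plain budget of an even observable vanishes identically (census F2) but the
odd-weighted ones do not. The open stub S2 (`stub_coSignedFloor`) asserts, under N = `GPEulerCoercive` (which the gap
implies, `tameGap_iff`), that above an enstrophy threshold every even admissible near-statistics of `f_GP` admits an
odd-weighted product witness of cost `≤ 2√G` and budget `≥ 2c` — the CO-SIGNED FLOOR of the card (designated weight:
the sign of the resolved spectral flux). `TameToRough_of` composes S0–S2 into the crux BY NAME.

STATUS (lead, cycle 1, 2026-08-17). S0 and S1 are LANDED (imported below). S2 is OPEN and is KERNEL-EQUIVALENT TO THE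
CRUX: `Theorems/TameRoughRigidityTameToRoughWitnessForm.lean` (p162200) proves `coSignedFloor_of_target : X → S2-body`
(X = `GPStatisticalRigidity`, the route's target, stmt-15508) and `coSignedFloor_iff_tameToRough : (N → S2-body) ↔ TameToRough`
(steps in `…WitnessFormSteps.lean`, p161779; tools p161179, p161056). Hence no reshape inside this line makes S2 smaller
than R itself; R closes by `TameToRough.Negative.tameToRough_iff_imp.2 (fun _ _ => hX)` the moment X lands.

STATUS (continuation lead c1, 2026-08-17). Skeleton re-registered unchanged (1 sorry = S2). The two-variable residual form is
landed as `Theorems/TameRoughRigidityTameToRoughResidual.lean` (p163702, registered `stub_residualFormTools`):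
`tameToRough_of_target : X → R` (the parking certificate), `gpEulerCoercive_of_target : X → N`,
`tameToRough_iff_coercive_imp_target : R ↔ (N → X)` (K = `TameClosure_of` landed), `target_iff_coercive_and_tameToRough :
X ↔ (N ∧ R)`. Verdict of this seat: S2 is not false and not misstated; it is the crux, and the crux is X conditioned on N; the
line is driven to its terminal state and R is parked behind X (stmt-15508): `blocked-on: stmt-AnomalousDissipation-15508`.

## References

* C. Foias, O. Manley, R. Rosa, R. Temam, *Navier–Stokes Equations and Turbulence*, CUP (2001), Ch. IV §1.2
  Def. 1.2–1.3, (1.27)–(1.31). [FoiasManleyRosaTemam2001]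
* U. S. Fjordholm, E. Wiedemann, *Statistical solutions and Onsager's conjecture*, arXiv:1706.04113, Thm 3.8.
* `Cruxes/TameToRough/{STRATEGY-CENSUS.md, NormalForm.lean, Ideas/cosigned-flux-witness.md}`;
  `Theorems/TameToRough/Negative/Structure.lean` (`tameGap_iff`, `tameToRough_iff_imp`).
-/

set_option linter.dupNamespace false

noncomputable section

namespace Summit.AnomalousDissipation.AnomalousDissipation.Theorems.TameRoughRigidity.TameToRough

open MeasureTheory Filter Topology UnitAddTorus
open scoped InnerProductSpace RealInnerProductSpace ENNReal NNReal
open Literature.Analysis.FunctionSpaces Literature.Analysis.FluidPDE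
open Summit.AnomalousDissipation.AnomalousDissipation.Theses.TameRoughRigidity
open Summit.AnomalousDissipation.AnomalousDissipation.Theorems.GPStatisticalRigidity.Negative
open Summit.AnomalousDissipation.AnomalousDissipation.Theorems.TameToRough.Negative

/-- Local notation: real vector fields on `T³`. -/
local notation "Vec3" => (UnitAddTorus (Fin 3)) → (EuclideanSpace ℝ (Fin 3))
/-- Local notation: `L²(T³; ℝ³)`. -/
local notation "L2" => (Lp (EuclideanSpace ℝ (Fin 3)) 2 (volume : Measure (UnitAddTorus (Fin 3))))
/-- Local notation: the energy space `H`. -/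
local notation "H3" => (Torus.energySpace (Fin 3))

/-! ### S0, S1 — LANDED

* S0 `stub_evenSymmetrise` — `Theorems/TameRoughRigidityTameToRoughEvenSymmetrise.lean` (p158598): time-reversal
  symmetrisation keeps energy, enstrophy, the defect constant and yields an EVEN measure with zero shell work.
* S1 `stub_oddWeightedBudget` — `Theorems/TameRoughRigidityTameToRoughOddWeightedBudget.lean` (p159222): the
  product-test budget inequality `|∫ (ψ ⟨F₀,Φ'⟩ + Φ ⟨F₀,Ψ'⟩) dμ| ≤ R (‖∇Φ'‖_{L²(μ;L²)} + K ‖∇Ψ'‖_{L²(μ;L²)})`.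
Both are imported above (same namespace). -/

/-! ### S2 — the co-signed floor (OPEN: the line's content) -/

/-- **S2 `stub_coSignedFloor`** (card: `CoSignedFloor`; OPEN, summit-strength by census F6). Under N (`f_GP`
carries no stationary Euler statistics in the FMRT class — implied by the tame gap, `tameGap_iff`), at every
energy level `E` there are a threshold `G₁` and constants `c, δ₀ > 0` such that every EVEN admissible near-statistics
`μ` of `f_GP` (probability, `T_*μ = μ`, integrable energy `≤ E`, finite mean enstrophy `G ≥ G₁`, shell work `≥ 0`)
with defect constant `R ≤ δ₀` admits an ODD-WEIGHTED PRODUCT WITNESS: a cylindrical `Φ` with even profile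
`|φ| ≤ K` (a cut-off resolved energy) and an odd compactly supported `C¹` weight `|ψ| ≤ 1` of the same coordinates
(designated: a smoothed sign of the resolved spectral flux) whose gradient cost is `≤ 2√G` and whose budget is
`≥ 2c` in absolute value. With S1 this is `2c ≤ 2R√G`. Why it might fail: a GP family of symmetrised NS statistics
with vanishing dissipation `ε_ν → 0`, `G_ν → ∞` (no zeroth law), or co-sign factors `A_N → 0` on every shell. -/
theorem stub_coSignedFloor (hN : GPEulerCoercive) (E : ℝ) :
    ∃ G₁ c δ₀ : ℝ, 0 < c ∧ 0 < δ₀ ∧ ∀ μ : Measure H3, IsProbabilityMeasure μ →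
      Integrable (fun v : H3 => ‖v‖ ^ 2) μ → Torus.ensembleEnergy μ ≤ E → Torus.ensembleEnstrophy μ < ⊤ →
      ENNReal.ofReal G₁ ≤ Torus.ensembleEnstrophy μ → ShellWorkNonneg gpForce μ →
      μ.map (fun v : H3 => -v) = μ →
      ∀ R : ℝ, 0 ≤ R → R ≤ δ₀ → DefectLE gpForce μ R →
        ∃ (Φ : Torus.CylindricalTest (Fin 3)) (ψ : EuclideanSpace ℝ (Fin Φ.m) → ℝ) (K : ℝ),
          ContDiff ℝ 1 ψ ∧ HasCompactSupport ψ ∧ (∀ c, |ψ c| ≤ 1) ∧ (∀ c, ψ (-c) = -ψ c) ∧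
          (∀ c, Φ.φ (-c) = Φ.φ c) ∧ (∀ c, |Φ.φ c| ≤ K) ∧
          Real.sqrt (∫ v, Torus.gradNormSq (Φ.grad v) ∂μ) +
              K * Real.sqrt (∫ v, Torus.gradNormSq
                (fun x => ∑ i, (fderiv ℝ ψ (Φ.coords v) (EuclideanSpace.single i 1)) • Φ.g i x) ∂μ) ≤
            2 * Real.sqrt (Torus.ensembleEnstrophy μ).toReal ∧
          2 * c ≤ |∫ v, (ψ (Φ.coords v) * Torus.nsGeneratorPairing 0 gpForce v (Φ.grad v) +
              Φ.eval v * Torus.nsGeneratorPairing 0 gpForce v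
                (fun x => ∑ i, (fderiv ℝ ψ (Φ.coords v) (EuclideanSpace.single i 1)) • Φ.g i x)) ∂μ| := by
  sorry

/-! ### The composition: the crux BY NAME -/

/-- **R from S0–S2.** `TameToRough`: the tame gap gives N (`tameGap_iff`); symmetrise the given admissible
near-statistics (S0: same `E`-bound, same `G`, same `R`, even, shell work `0`); take the odd-weighted product witness
of S2 on the symmetrised measure; bound its budget by S1; divide `2c ≤ R · 2√G` by two. -/
theorem TameToRough_of : TameToRough := by
  intro f hf gap E
  subst hf
  -- the tame gap implies N (and K): refuter's structure theorem
  have hN : GPEulerCoercive := (tameGap_iff.1 gap).1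
  obtain ⟨G₁, c, δ₀, hc, hδ₀, hfloor⟩ := stub_coSignedFloor hN E
  refine ⟨G₁, c, δ₀, hc, hδ₀, ?_⟩
  intro μ hprob hint hE hfin hth _hshell R hR0 hRδ hdef
  obtain ⟨hsm, -, -⟩ :=
    Summit.AnomalousDissipation.AnomalousDissipation.Theorems.SteadyStatesLoudBounded.GpAdmissible.stub_gpAdmissible
  have hf2 : MemLp gpForce 2 volume := hsm.memLp 2
  -- S0: symmetrise
  obtain ⟨μ', hprob', hint', hE', hG', heven, hshell', hdef'⟩ :=
    stub_evenSymmetrise gpForce hf2 μ hprob hint R hR0 hdef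
  have hEle : Torus.ensembleEnergy μ' ≤ E := hE'.symm ▸ hE
  have hfin' : Torus.ensembleEnstrophy μ' < ⊤ := hG'.symm ▸ hfin
  have hth' : ENNReal.ofReal G₁ ≤ Torus.ensembleEnstrophy μ' := hG'.symm ▸ hth
  -- S2: the odd-weighted product witness on the even measure
  obtain ⟨Φ, ψ, K, hψ, hψc, hψ1, -, -, hφK, hcost, hbudget⟩ :=
    hfloor μ' hprob' hint' hEle hfin' hth' hshell' heven R hR0 hRδ hdef'
  -- S1: its budget is bounded by the defect at the critical tolerance
  have hS1 := stub_oddWeightedBudget gpForce hsm μ' hprob' R K hR0 hdef' Φ ψ hψ hψc hψ1 hφK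
  rw [hG'] at hcost
  have key : 2 * c ≤ R * (2 * Real.sqrt (Torus.ensembleEnstrophy μ).toReal) :=
    hbudget.trans (hS1.trans (mul_le_mul_of_nonneg_left hcost hR0))
  linarith

end Summit.AnomalousDissipation.AnomalousDissipation.Theorems.TameRoughRigidity.TameToRough

end
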